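import Summits.PneNP.PneNP.Theorems.ConvexRankGatesCliqueExtLowerBoundWidthThresholdNarrow
import Summits.PneNP.PneNP.Theorems.CliqueExtLowerBound.Negative.GRankConsequences
import Summits.PneNP.PneNP.Theorems.LinAlgGateBlind.Negative.ValiantCertificate

/-!
# Calibration of the stub `stub_grankSandwichable` (line `width-threshold-certificate-sparsity`,
crux `CliqueExtLowerBound`, stmt-PneNP-10682, route PneNP/ConvexRankGates)

The registered stub `stub_grankSandwichable` of the line's skeleton (r4) says: every WIDE
generic-rank threshold gate (dimension `≤ m^c`, any field, but not of width `≤ ⌊m^{1/16}⌋₊`), fed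
with local child pairs, is `(r,s)`-sandwichable on the referee pair (bare `⌈m^{1/4}⌉₊`-cliques vs
complements of `#E/⌊m^{1/8}⌋₊`-edge graphs) with error `1/(8 m^{c+1})`.

This file does NOT prove the stub. It CALIBRATES it: taken as an explicit hypothesis `hG` (written
out verbatim, no abbreviating definition), the stub implies, with everything else LANDED,

* `grankLowerBound_of_grankSandwichable` — the lower bound over the GRANK-only sub-basis
  `{∧₂, ∨₂} ∪ GRANK_{m^c}` at `δ = 1/4` (`Negative.GRankLowerBoundAt (fun m => ⌈m^{1/4}⌉₊)`): for
  every `c`, eventually in `m`, no circuit with `≤ m^c` gates over that basis computes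
  `CLIQUE(m, ⌈m^{1/4}⌉₊)`. Proof = the composition pattern of `narrowLowerBound`
  (`…WidthThresholdNarrow`): `∧₂/∨₂` replace themselves (`inline_statement 0 c`), narrow GRANK gates
  by `narrowAlgebraic_statement c`, wide GRANK gates by `hG`, referee by `referee_statement s`, all
  combined by `core`;
* `oneGRankGate_blind_of_grankSandwichable` — hence NO single GRANK gate of dimension `≤ m^c` (any
  field, any wiring of its inputs to edges) computes `CLIQUE(m, ⌈m^{1/4}⌉₊)`, eventually in `m`;
* `not_hasDetRepr_cliquePoly_of_grankSandwichable`,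
  `determinantalComplexity_cliquePoly_of_grankSandwichable` — hence, over EVERY field `F` and for
  every `c`, eventually in `m`, the clique polynomial `CL_{m, ⌈m^{1/4}⌉₊}` has no affine determinantal
  representation of size `≤ m^c`, i.e. `dc(CL_{m,⌈m^{1/4}⌉₊}) > m^c`: a superpolynomial
  determinantal-complexity lower bound for an explicit VNP family in every characteristic
  (Valiant 1979; the best proved explicit bound is quadratic, Mignon–Ressayre 2004).

So the stub is (at least) Valiant-hard. The schedule-generic forms
(`oneGRankGate_blind_of_grankLowerBoundAt`, `not_hasDetRepr_cliquePoly_of_grankLowerBoundAt`,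
`determinantalComplexity_cliquePoly_of_grankLowerBoundAt`) are recorded for any schedule `k` with
`k m ≥ 2` eventually.

References: S. Jukna, *Boolean Function Complexity* (2012), Thm. 9.17 [Jukna2012]; L. G. Valiant,
*Completeness classes in algebra* (1979) [Valiant1979]; T. Mignon, N. Ressayre (2004)
[MignonRessayre2004].
-/

set_option linter.dupNamespace false

open Literature.Computability.Complexity Filter Finset
open Summit.PneNP.PneNP.Theorems.CliqueExtLowerBound.Negative (GRankLowerBoundAt two_le_ceil_rpow)
open Summit.PneNP.PneNP.Theorems.LinAlgGateBlind.Negative (cliquePoly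
  exists_oneGRankGate_of_hasDetRepr_cliquePoly)

noncomputable section

namespace Summit.PneNP.PneNP.Theorems.CliqueExtLowerBound.WidthThreshold.GRankCalibration

/-! ## §1 The stub implies the GRANK-only lower bound at `δ = 1/4` -/

open Classical in
/-- **Calibration, master form.** If every wide GRANK gate (dimension `≤ m^c`, not of width
`≤ ⌊m^{1/16}⌋₊`) fed with local child pairs is `(r,s)`-sandwichable on the referee pair with error
`1/(8m^{c+1})` (the registered stub `stub_grankSandwichable`, verbatim, as hypothesis `hG`), then
the lower bound holds over the GRANK-only sub-basis `{∧₂, ∨₂} ∪ GRANK_{m^c}` at `δ = 1/4`: for every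
`c`, eventually in `m`, no circuit with `≤ m^c` such gates computes `CLIQUE(m, ⌈m^{1/4}⌉₊)`.
Composition of the landed `inline_statement 0 c` (`∧₂, ∨₂` replace themselves),
`narrowAlgebraic_statement c` (narrow GRANK gates), `hG` (wide GRANK gates), `referee_statement s`
and `core`. [cite: Jukna2012, Thm. 9.17] -/
theorem grankLowerBound_of_grankSandwichable :
    (∀ c : ℕ, ∃ r₀ s₀ : ℕ, 2 ≤ r₀ ∧ 2 ≤ s₀ ∧ ∀ r s : ℕ, r₀ ≤ r → s₀ ≤ s →
      ∀ᶠ m : ℕ in atTop, ∀ φ : GateFn, IsGRankGate (m ^ c) φ →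
        ¬ (IsPermGate ⌊(m : ℝ) ^ (1 / 16 : ℝ)⌋₊ φ ∨ IsGRankGate ⌊(m : ℝ) ^ (1 / 16 : ℝ)⌋₊ φ) →
        ∀ (D C : Fin φ.1 → Finset (Finset ((⊤ : SimpleGraph (Fin m)).edgeSet))),
          #(univ.image fun j => (D j, C j)) ≤ m ^ (c + 3) →
          (∀ j, ∀ R ∈ D j, #R ≤ r - 1) → (∀ j, ∀ S ∈ C j, #S ≤ s - 1) →
          (∀ j x, EvalDNF (D j) x → EvalCNF (C j) x) →
          ∃ dnf cnf : Finset (Finset ((⊤ : SimpleGraph (Fin m)).edgeSet)),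
            (∀ R ∈ dnf, #R ≤ r - 1) ∧ (∀ S ∈ cnf, #S ≤ s - 1) ∧
            (∀ x, EvalDNF dnf x → EvalCNF cnf x) ∧
            (#((posGraphs m ⌈(m : ℝ) ^ (1 / 4 : ℝ)⌉₊).filter
                (fun x => φ.2 (fun j => decide (EvalDNF (D j) x)) = true ∧ ¬ EvalDNF dnf x)) : ℝ)
              ≤ (1 / (8 * (m : ℝ) ^ (c + 1))) * #(posGraphs m ⌈(m : ℝ) ^ (1 / 4 : ℝ)⌉₊) ∧
            (#((((powersetCard (Fintype.card ((⊤ : SimpleGraph (Fin m)).edgeSet) /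
                ⌊(m : ℝ) ^ (1 / 8 : ℝ)⌋₊) (univ : Finset ((⊤ : SimpleGraph (Fin m)).edgeSet))).image
                (fun M => fun e => decide (e ∉ M)))).filter
                (fun x => EvalCNF cnf x ∧ φ.2 (fun j => decide (EvalCNF (C j) x)) = false)) : ℝ)
              ≤ (1 / (8 * (m : ℝ) ^ (c + 1))) *
                #(((powersetCard (Fintype.card ((⊤ : SimpleGraph (Fin m)).edgeSet) /
                  ⌊(m : ℝ) ^ (1 / 8 : ℝ)⌋₊) (univ : Finset ((⊤ : SimpleGraph (Fin m)).edgeSet))).image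
                  (fun M => fun e => decide (e ∉ M))))) →
    Summit.PneNP.PneNP.Theorems.CliqueExtLowerBound.Negative.GRankLowerBoundAt
      (fun m => ⌈(m : ℝ) ^ (1 / 4 : ℝ)⌉₊) := by
  intro hG c
  obtain ⟨r₁, s₁, hr₁, hs₁, hI₁⟩ := inline_statement 0 c
  obtain ⟨r₂, s₂, hr₂, hs₂, hW⟩ := hG c
  obtain ⟨r₃, s₃, hr₃, hs₃, hN⟩ := narrowAlgebraic_statement c
  set r := max r₁ (max r₂ r₃) with hr
  set s := max s₁ (max s₂ s₃) with hs
  have hr2 : 2 ≤ r := le_trans hr₁ (le_max_left _ _)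
  have hs2 : 2 ≤ s := le_trans hs₁ (le_max_left _ _)
  have E₁ := hI₁ r s (le_max_left _ _) (le_max_left _ _)
  have E₂ := hW r s ((le_max_left _ _).trans (le_max_right _ _))
    ((le_max_left _ _).trans (le_max_right _ _))
  have E₃ := hN r s ((le_max_right _ _).trans (le_max_right _ _))
    ((le_max_right _ _).trans (le_max_right _ _))
  have E₆ := referee_statement s
  filter_upwards [E₁, E₂, E₃, E₆, eventually_ge_atTop 3] with m h₁ h₂ h₃ h₆ hm C hC hsize
  have hε0 : 0 ≤ eps m c := by unfold eps; positivity
  have htwo : eps m c + eps m c = 2 * eps m c := by ring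
  refine core hr2 hs2 hm h₆.1 h₆.2
    (B := monotoneBasis ∪ {g | IsGRankGate (m ^ c) g}) ?_ ?_ C hC hsize
  · rintro φ (hφ | hφ)
    · rcases hφ with rfl | rfl
      · exact GateFn.and_monotone 2
      · exact GateFn.or_monotone 2
    · exact IsGRankGate.monotone hφ
  · rintro φ (hφ | hφ)
    · rw [pow_zero] at h₁
      exact htwo ▸ sandwichable_of_replaceable (replaceable_of_mem_monotoneBasis le_rfl hε0 hφ) h₁
    · by_cases hn : IsPermGate (TT m) φ ∨ IsGRankGate (TT m) φ
      · exact (h₃ φ hn).of_le (by linarith)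
      · have hφ' : IsGRankGate (m ^ c) φ := hφ
        have key : Sandwichable r s (m ^ (c + 3)) (posFam m) (negFam m) (eps m c) φ :=
          h₂ φ hφ' hn
        exact key.of_le (by linarith)

/-! ## §2 Consequences of the GRANK-only lower bound (schedule-generic) -/

/-- A GRANK-only lower bound at schedule `k` forbids ONE GRANK gate: for every `c`, eventually in
`m`, no single GRANK gate of dimension `≤ m^c` — any field, any number `n` of inputs, input `i`
reading the edge `w i` — computes `CLIQUE(m, k m)` (it would be a size-`1` circuit over
`{∧₂, ∨₂} ∪ GRANK_{m^c}`). [folklore] -/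
theorem oneGRankGate_blind_of_grankLowerBoundAt {k : ℕ → ℕ} (h : GRankLowerBoundAt k) :
    ∀ c : ℕ, ∀ᶠ m : ℕ in atTop,
      ∀ (n : ℕ) (f : (Fin n → Bool) → Bool) (w : Fin n → (⊤ : SimpleGraph (Fin m)).edgeSet),
        IsGRankGate (m ^ c) ⟨n, f⟩ →
        ¬ ∀ x : (⊤ : SimpleGraph (Fin m)).edgeSet → Bool, f (fun i => x (w i)) = cliqueFn m (k m) x := by
  intro c
  filter_upwards [h c, eventually_ge_atTop 1] with m hm h1 n f w hgate hcomp
  obtain ⟨C, hC, hs, he⟩ :=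
    (CktSize.gate (B := {GateFn.and 2, GateFn.or 2} ∪ {g | IsGRankGate (m ^ c) g}) ⟨n, f⟩
      (Or.inr hgate) w).toCircuit
  refine hm C hC (hs.trans (Nat.one_le_pow _ _ h1)) fun x => ?_
  rw [he x]
  exact hcomp x

/-- A GRANK-only lower bound at a schedule `k` with `k m ≥ 2` eventually forbids small affine
determinantal representations of the clique polynomials over EVERY field: for every `c`,
eventually in `m`, `¬ HasDetRepr (CL_{m, k m}) d` for all `d ≤ m^c` (such a representation is one
`GRANK_d` gate computing `CLIQUE(m, k m)`, `exists_oneGRankGate_of_hasDetRepr_cliquePoly`).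
[folklore] -/
theorem not_hasDetRepr_cliquePoly_of_grankLowerBoundAt {k : ℕ → ℕ} (h : GRankLowerBoundAt k)
    (hk : ∀ᶠ m : ℕ in atTop, 2 ≤ k m) :
    ∀ (F : Type) [Field F] (c : ℕ), ∀ᶠ m : ℕ in atTop, ∀ d ≤ m ^ c,
      ¬ Literature.Computability.AlgebraicComplexity.HasDetRepr (cliquePoly m F (k m)) d := by
  intro F _ c
  filter_upwards [h c, hk, eventually_ge_atTop 1] with m hm h2 h1 d hd hrepr
  obtain ⟨C, hC, hs, hc⟩ := exists_oneGRankGate_of_hasDetRepr_cliquePoly h2 hrepr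
  exact hm C (hC.mono fun g hg => Or.inr (IsGRankGate.mono hg hd))
    (hs.trans (Nat.one_le_pow _ _ h1)) hc

/-- The same in terms of `determinantalComplexity`: `m ^ c < dc (CL_{m, k m})` eventually in `m`,
over every field. [folklore] -/
theorem determinantalComplexity_cliquePoly_of_grankLowerBoundAt {k : ℕ → ℕ}
    (h : GRankLowerBoundAt k) (hk : ∀ᶠ m : ℕ in atTop, 2 ≤ k m) :
    ∀ (F : Type) [Field F] (c : ℕ), ∀ᶠ m : ℕ in atTop,
      m ^ c < Literature.Computability.AlgebraicComplexity.determinantalComplexity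
        (cliquePoly m F (k m)) := by
  intro F _ c
  filter_upwards [not_hasDetRepr_cliquePoly_of_grankLowerBoundAt h hk F c] with m hm
  by_contra hle
  push Not at hle
  exact hm _ hle
    (Literature.Computability.AlgebraicComplexity.hasDetRepr_determinantalComplexity_holds _)

/-! ## §3 The calibration of the stub in single-gate and Valiant language -/

open Classical in
/-- **The stub forbids ONE GRANK gate.** Under `stub_grankSandwichable` (verbatim, as `hG`): for
every `c`, eventually in `m`, NO single GRANK gate of dimension `≤ m^c` — any field, any number
`n` of inputs, input `i` reading the edge `w i`, repeated wires allowed — computes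
`CLIQUE(m, ⌈m^{1/4}⌉₊)`. [folklore] -/
theorem oneGRankGate_blind_of_grankSandwichable
    (hG : ∀ c : ℕ, ∃ r₀ s₀ : ℕ, 2 ≤ r₀ ∧ 2 ≤ s₀ ∧ ∀ r s : ℕ, r₀ ≤ r → s₀ ≤ s →
      ∀ᶠ m : ℕ in atTop, ∀ φ : GateFn, IsGRankGate (m ^ c) φ →
        ¬ (IsPermGate ⌊(m : ℝ) ^ (1 / 16 : ℝ)⌋₊ φ ∨ IsGRankGate ⌊(m : ℝ) ^ (1 / 16 : ℝ)⌋₊ φ) →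
        ∀ (D C : Fin φ.1 → Finset (Finset ((⊤ : SimpleGraph (Fin m)).edgeSet))),
          #(univ.image fun j => (D j, C j)) ≤ m ^ (c + 3) →
          (∀ j, ∀ R ∈ D j, #R ≤ r - 1) → (∀ j, ∀ S ∈ C j, #S ≤ s - 1) →
          (∀ j x, EvalDNF (D j) x → EvalCNF (C j) x) →
          ∃ dnf cnf : Finset (Finset ((⊤ : SimpleGraph (Fin m)).edgeSet)),
            (∀ R ∈ dnf, #R ≤ r - 1) ∧ (∀ S ∈ cnf, #S ≤ s - 1) ∧
            (∀ x, EvalDNF dnf x → EvalCNF cnf x) ∧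
            (#((posGraphs m ⌈(m : ℝ) ^ (1 / 4 : ℝ)⌉₊).filter
                (fun x => φ.2 (fun j => decide (EvalDNF (D j) x)) = true ∧ ¬ EvalDNF dnf x)) : ℝ)
              ≤ (1 / (8 * (m : ℝ) ^ (c + 1))) * #(posGraphs m ⌈(m : ℝ) ^ (1 / 4 : ℝ)⌉₊) ∧
            (#((((powersetCard (Fintype.card ((⊤ : SimpleGraph (Fin m)).edgeSet) /
                ⌊(m : ℝ) ^ (1 / 8 : ℝ)⌋₊) (univ : Finset ((⊤ : SimpleGraph (Fin m)).edgeSet))).image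
                (fun M => fun e => decide (e ∉ M)))).filter
                (fun x => EvalCNF cnf x ∧ φ.2 (fun j => decide (EvalCNF (C j) x)) = false)) : ℝ)
              ≤ (1 / (8 * (m : ℝ) ^ (c + 1))) *
                #(((powersetCard (Fintype.card ((⊤ : SimpleGraph (Fin m)).edgeSet) /
                  ⌊(m : ℝ) ^ (1 / 8 : ℝ)⌋₊) (univ : Finset ((⊤ : SimpleGraph (Fin m)).edgeSet))).image
                  (fun M => fun e => decide (e ∉ M))))) :
    ∀ c : ℕ, ∀ᶠ m : ℕ in atTop,
      ∀ (n : ℕ) (f : (Fin n → Bool) → Bool) (w : Fin n → (⊤ : SimpleGraph (Fin m)).edgeSet),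
        IsGRankGate (m ^ c) ⟨n, f⟩ →
        ¬ ∀ x : (⊤ : SimpleGraph (Fin m)).edgeSet → Bool,
          f (fun i => x (w i)) = cliqueFn m ⌈(m : ℝ) ^ (1 / 4 : ℝ)⌉₊ x :=
  oneGRankGate_blind_of_grankLowerBoundAt (grankLowerBound_of_grankSandwichable hG)

open Classical in
/-- **The stub is Valiant-hard (determinantal representations).** Under `stub_grankSandwichable`
(verbatim, as `hG`): over EVERY field `F`, for every `c`, eventually in `m`, the clique polynomial
`CL_{m, ⌈m^{1/4}⌉₊}` has NO affine determinantal representation of size `d ≤ m^c` — a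
superpolynomial determinantal-complexity lower bound for an explicit VNP family in every
characteristic (cf. Valiant 1979; best proved explicit bound quadratic, Mignon–Ressayre 2004).
[folklore] -/
theorem not_hasDetRepr_cliquePoly_of_grankSandwichable
    (hG : ∀ c : ℕ, ∃ r₀ s₀ : ℕ, 2 ≤ r₀ ∧ 2 ≤ s₀ ∧ ∀ r s : ℕ, r₀ ≤ r → s₀ ≤ s →
      ∀ᶠ m : ℕ in atTop, ∀ φ : GateFn, IsGRankGate (m ^ c) φ →
        ¬ (IsPermGate ⌊(m : ℝ) ^ (1 / 16 : ℝ)⌋₊ φ ∨ IsGRankGate ⌊(m : ℝ) ^ (1 / 16 : ℝ)⌋₊ φ) →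
        ∀ (D C : Fin φ.1 → Finset (Finset ((⊤ : SimpleGraph (Fin m)).edgeSet))),
          #(univ.image fun j => (D j, C j)) ≤ m ^ (c + 3) →
          (∀ j, ∀ R ∈ D j, #R ≤ r - 1) → (∀ j, ∀ S ∈ C j, #S ≤ s - 1) →
          (∀ j x, EvalDNF (D j) x → EvalCNF (C j) x) →
          ∃ dnf cnf : Finset (Finset ((⊤ : SimpleGraph (Fin m)).edgeSet)),
            (∀ R ∈ dnf, #R ≤ r - 1) ∧ (∀ S ∈ cnf, #S ≤ s - 1) ∧
            (∀ x, EvalDNF dnf x → EvalCNF cnf x) ∧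
            (#((posGraphs m ⌈(m : ℝ) ^ (1 / 4 : ℝ)⌉₊).filter
                (fun x => φ.2 (fun j => decide (EvalDNF (D j) x)) = true ∧ ¬ EvalDNF dnf x)) : ℝ)
              ≤ (1 / (8 * (m : ℝ) ^ (c + 1))) * #(posGraphs m ⌈(m : ℝ) ^ (1 / 4 : ℝ)⌉₊) ∧
            (#((((powersetCard (Fintype.card ((⊤ : SimpleGraph (Fin m)).edgeSet) /
                ⌊(m : ℝ) ^ (1 / 8 : ℝ)⌋₊) (univ : Finset ((⊤ : SimpleGraph (Fin m)).edgeSet))).image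
                (fun M => fun e => decide (e ∉ M)))).filter
                (fun x => EvalCNF cnf x ∧ φ.2 (fun j => decide (EvalCNF (C j) x)) = false)) : ℝ)
              ≤ (1 / (8 * (m : ℝ) ^ (c + 1))) *
                #(((powersetCard (Fintype.card ((⊤ : SimpleGraph (Fin m)).edgeSet) /
                  ⌊(m : ℝ) ^ (1 / 8 : ℝ)⌋₊) (univ : Finset ((⊤ : SimpleGraph (Fin m)).edgeSet))).image
                  (fun M => fun e => decide (e ∉ M))))) :
    ∀ (F : Type) [Field F] (c : ℕ), ∀ᶠ m : ℕ in atTop, ∀ d ≤ m ^ c,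
      ¬ Literature.Computability.AlgebraicComplexity.HasDetRepr
        (cliquePoly m F ⌈(m : ℝ) ^ (1 / 4 : ℝ)⌉₊) d :=
  not_hasDetRepr_cliquePoly_of_grankLowerBoundAt (grankLowerBound_of_grankSandwichable hG)
    (by filter_upwards [eventually_ge_atTop 2] with m hm; exact two_le_ceil_rpow (by norm_num) hm)

open Classical in
/-- **The stub is Valiant-hard (determinantal complexity).** Under `stub_grankSandwichable`
(verbatim, as `hG`): over EVERY field `F`, for every `c`, `m ^ c < dc (CL_{m, ⌈m^{1/4}⌉₊})`
eventually in `m`. [folklore] -/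
theorem determinantalComplexity_cliquePoly_of_grankSandwichable
    (hG : ∀ c : ℕ, ∃ r₀ s₀ : ℕ, 2 ≤ r₀ ∧ 2 ≤ s₀ ∧ ∀ r s : ℕ, r₀ ≤ r → s₀ ≤ s →
      ∀ᶠ m : ℕ in atTop, ∀ φ : GateFn, IsGRankGate (m ^ c) φ →
        ¬ (IsPermGate ⌊(m : ℝ) ^ (1 / 16 : ℝ)⌋₊ φ ∨ IsGRankGate ⌊(m : ℝ) ^ (1 / 16 : ℝ)⌋₊ φ) →
        ∀ (D C : Fin φ.1 → Finset (Finset ((⊤ : SimpleGraph (Fin m)).edgeSet))),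
          #(univ.image fun j => (D j, C j)) ≤ m ^ (c + 3) →
          (∀ j, ∀ R ∈ D j, #R ≤ r - 1) → (∀ j, ∀ S ∈ C j, #S ≤ s - 1) →
          (∀ j x, EvalDNF (D j) x → EvalCNF (C j) x) →
          ∃ dnf cnf : Finset (Finset ((⊤ : SimpleGraph (Fin m)).edgeSet)),
            (∀ R ∈ dnf, #R ≤ r - 1) ∧ (∀ S ∈ cnf, #S ≤ s - 1) ∧
            (∀ x, EvalDNF dnf x → EvalCNF cnf x) ∧
            (#((posGraphs m ⌈(m : ℝ) ^ (1 / 4 : ℝ)⌉₊).filter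
                (fun x => φ.2 (fun j => decide (EvalDNF (D j) x)) = true ∧ ¬ EvalDNF dnf x)) : ℝ)
              ≤ (1 / (8 * (m : ℝ) ^ (c + 1))) * #(posGraphs m ⌈(m : ℝ) ^ (1 / 4 : ℝ)⌉₊) ∧
            (#((((powersetCard (Fintype.card ((⊤ : SimpleGraph (Fin m)).edgeSet) /
                ⌊(m : ℝ) ^ (1 / 8 : ℝ)⌋₊) (univ : Finset ((⊤ : SimpleGraph (Fin m)).edgeSet))).image
                (fun M => fun e => decide (e ∉ M)))).filter
                (fun x => EvalCNF cnf x ∧ φ.2 (fun j => decide (EvalCNF (C j) x)) = false)) : ℝ)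
              ≤ (1 / (8 * (m : ℝ) ^ (c + 1))) *
                #(((powersetCard (Fintype.card ((⊤ : SimpleGraph (Fin m)).edgeSet) /
                  ⌊(m : ℝ) ^ (1 / 8 : ℝ)⌋₊) (univ : Finset ((⊤ : SimpleGraph (Fin m)).edgeSet))).image
                  (fun M => fun e => decide (e ∉ M))))) :
    ∀ (F : Type) [Field F] (c : ℕ), ∀ᶠ m : ℕ in atTop,
      m ^ c < Literature.Computability.AlgebraicComplexity.determinantalComplexity
        (cliquePoly m F ⌈(m : ℝ) ^ (1 / 4 : ℝ)⌉₊) :=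
  determinantalComplexity_cliquePoly_of_grankLowerBoundAt (grankLowerBound_of_grankSandwichable hG)
    (by filter_upwards [eventually_ge_atTop 2] with m hm; exact two_le_ceil_rpow (by norm_num) hm)

end Summit.PneNP.PneNP.Theorems.CliqueExtLowerBound.WidthThreshold.GRankCalibration

end
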